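import Summits.Ventures.GridStability.Models.InverterNetworkHamiltonian
import Summits.Ventures.GridStability.Models.InverterNetworkLinearisation

/-!
# GridStability/Models/InverterNetworkVoltageLinearisation — the `3n × 3n` linearisation of the droop microgrid WITH Q–V voltage dynamics (model N1) and its rotation mode

Cell `gridfusion` (LADDER-GRIDFUSION, APEX LINE rung G3.b «droop microgrid with Q–V voltage dynamics»;
seat gridfusion-model-8 (g0); brief = gridfusion-lead 2026-08-27T08:25:47Z (i)). The typed model N1
`DroopMicrogrid` (`Models/InverterNetwork.lean` p464230: [cite: KunduEtAl2019, eqs. (4a)–(4c), (5a)–(5b)] =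
[cite: ShinZavala2020, eqs. (1a)–(1b), (8a)–(8c)]; states `(θ, ω, V)`, `3n` of them) was so far linearised only
at FROZEN voltages (`DroopMicrogrid.hasFDerivAt_freqField`, p497389: the `2n × 2n` classical block). Here:
* §1 the four power-flow sensitivity blocks at a state `(θ, V)` as explicit matrices — `Pθ = ∂P/∂θ`,
  `PV = ∂P/∂V`, `Qθ = ∂Q/∂θ`, `QV = ∂Q/∂V` (full sums, transfer conductances `G` KEPT, any `B`) — with
  `Pθ 1 = 0`, `Qθ 1 = 0` (rotational symmetry);
* §2 the Jacobian of the FULL field (4a)–(4c) as a block matrix `jacMatrix (θ, V)` on `Fin n ⊕ (Fin n ⊕ Fin n)`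
  (`[[0, 1, 0], [−Λ_P Pθ, −T_P⁻¹, −Λ_P PV], [−Λ_Q Qθ, 0, −T_Q⁻¹(1 + K_Q QV)]]`, `Λ_P = diag(k_P/τ_P)`,
  `Λ_Q = diag(k_Q/τ_Q)`), the same map as a continuous linear map `jacCLM`, `jacCLM_eq_mulVec`, and the
  kernel fact `hasFDerivAt_field`: the field is Fréchet differentiable at EVERY state with derivative
  `jacCLM x` (no hypothesis on the data; pattern = `ClassicalSwing.hasFDerivAt_field`);
* §3 the ROTATION MODE: `jacMatrix x [1; 0; 0] = 0` for every parameter set and every state (so a point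
  certificate must quotient the uniform angle shift, as in `WSCC9SPdampLinearisation.J5Q`);
The PORT-HAMILTONIAN FACTORISATION `jacMatrix x* = (J − R(x*))·Q(x*)` at a rest point (`G = 0`, for
model-3's `re_eig_nonpos_of_pH`) is the sibling file `Models/InverterNetworkVoltagePH.lean`; instances (row
#51 «G3.b-ss-DROOPQV-…-POINT») are separate files. Deliberately NOT here: any parameter value.
THREE COLUMNS. CERTIFIED (kernel, this file): calculus/algebra identities about the MODEL N1; no numbers.
MODELLED: MV-6N + MV-6D (network version; [cite: SchifferEtAl2014] §2–§3 modelling assumptions). VALIDATED: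
nothing. No sentence of this file says a converter or a microgrid is stable.
-/

noncomputable section

open Real Matrix Finset

namespace Summit.Ventures.GridStability.Models

namespace DroopMicrogrid

variable {n : ℕ} (mg : DroopMicrogrid n)

/-! ## §1 Power-flow sensitivities at a state `(θ, V)` -/

/-- The `(i, j)` flow kernel of `P_i`: `g_ij(θ) = G_ij cos θ_ij + B_ij sin θ_ij`. [cite: KunduEtAl2019, eq. (5a)] -/
def gP (θ : Fin n → ℝ) (i j : Fin n) : ℝ := mg.G i j * cos (θ i - θ j) + mg.B i j * sin (θ i - θ j)

/-- The `(i, j)` flow kernel of `Q_i`: `h_ij(θ) = G_ij sin θ_ij − B_ij cos θ_ij`. [cite: KunduEtAl2019, eq. (5b)] -/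
def gQ (θ : Fin n → ℝ) (i j : Fin n) : ℝ := mg.G i j * sin (θ i - θ j) - mg.B i j * cos (θ i - θ j)

/-- `∂g_ij/∂θ_i = −G_ij sin θ_ij + B_ij cos θ_ij` (`= −h_ij`). [folklore] -/
def dgP (θ : Fin n → ℝ) (i j : Fin n) : ℝ := -(mg.G i j * sin (θ i - θ j)) + mg.B i j * cos (θ i - θ j)

/-- Angle-sensitivity weights of `P`: `a_ij = V_iV_j(−G_ij sin θ_ij + B_ij cos θ_ij)`. [folklore] -/
def aP (θ V : Fin n → ℝ) : Matrix (Fin n) (Fin n) ℝ := fun i j => V i * V j * mg.dgP θ i j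

/-- Angle-sensitivity weights of `Q`: `b_ij = V_iV_j(G_ij cos θ_ij + B_ij sin θ_ij)` (`∂h_ij/∂θ_i = g_ij`). [folklore] -/
def aQ (θ V : Fin n → ℝ) : Matrix (Fin n) (Fin n) ℝ := fun i j => V i * V j * mg.gP θ i j

/-- **`Pθ = ∂P/∂θ`**: `(Pθ u)_i = Σ_j a_ij (u_i − u_j)`, i.e. `Pθ = diag(Σ_j a_ij) − a`. [folklore] -/
def Pθ (θ V : Fin n → ℝ) : Matrix (Fin n) (Fin n) ℝ :=
  Matrix.diagonal (fun i => ∑ j, mg.aP θ V i j) - mg.aP θ V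

/-- **`Qθ = ∂Q/∂θ`**: `(Qθ u)_i = Σ_j b_ij (u_i − u_j)`. [folklore] -/
def Qθ (θ V : Fin n → ℝ) : Matrix (Fin n) (Fin n) ℝ :=
  Matrix.diagonal (fun i => ∑ j, mg.aQ θ V i j) - mg.aQ θ V

/-- **`PV = ∂P/∂V`**: `(PV w)_i = Σ_j (w_iV_j + V_iw_j) g_ij = (Σ_j V_j g_ij) w_i + Σ_j V_i g_ij w_j`. [folklore] -/
def PV (θ V : Fin n → ℝ) : Matrix (Fin n) (Fin n) ℝ :=
  Matrix.diagonal (fun i => ∑ j, V j * mg.gP θ i j) + Matrix.of fun i j => V i * mg.gP θ i j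

/-- **`QV = ∂Q/∂V`**: `(QV w)_i = Σ_j (w_iV_j + V_iw_j) h_ij`. [folklore] -/
def QV (θ V : Fin n → ℝ) : Matrix (Fin n) (Fin n) ℝ :=
  Matrix.diagonal (fun i => ∑ j, V j * mg.gQ θ i j) + Matrix.of fun i j => V i * mg.gQ θ i j

/-- `(Pθ u)_i = Σ_j a_ij (u_i − u_j)`. [folklore] -/
theorem Pθ_mulVec (θ V u : Fin n → ℝ) (i : Fin n) :
    (mg.Pθ θ V *ᵥ u) i = ∑ j, mg.aP θ V i j * (u i - u j) := by
  rw [Pθ, Matrix.sub_mulVec, Pi.sub_apply, Matrix.mulVec_diagonal]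
  simp only [Matrix.mulVec, dotProduct, Finset.sum_mul, ← Finset.sum_sub_distrib]
  refine Finset.sum_congr rfl fun j _ => ?_
  ring

/-- `(Qθ u)_i = Σ_j b_ij (u_i − u_j)`. [folklore] -/
theorem Qθ_mulVec (θ V u : Fin n → ℝ) (i : Fin n) :
    (mg.Qθ θ V *ᵥ u) i = ∑ j, mg.aQ θ V i j * (u i - u j) := by
  rw [Qθ, Matrix.sub_mulVec, Pi.sub_apply, Matrix.mulVec_diagonal]
  simp only [Matrix.mulVec, dotProduct, Finset.sum_mul, ← Finset.sum_sub_distrib]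
  refine Finset.sum_congr rfl fun j _ => ?_
  ring

/-- `(PV w)_i = Σ_j (w_iV_j + V_iw_j) g_ij`. [folklore] -/
theorem PV_mulVec (θ V w : Fin n → ℝ) (i : Fin n) :
    (mg.PV θ V *ᵥ w) i = ∑ j, (w i * V j + V i * w j) * mg.gP θ i j := by
  rw [PV, Matrix.add_mulVec, Pi.add_apply, Matrix.mulVec_diagonal]
  simp only [Matrix.mulVec, dotProduct, Matrix.of_apply, Finset.sum_mul, ← Finset.sum_add_distrib]
  refine Finset.sum_congr rfl fun j _ => ?_
  ring

/-- `(QV w)_i = Σ_j (w_iV_j + V_iw_j) h_ij`. [folklore] -/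
theorem QV_mulVec (θ V w : Fin n → ℝ) (i : Fin n) :
    (mg.QV θ V *ᵥ w) i = ∑ j, (w i * V j + V i * w j) * mg.gQ θ i j := by
  rw [QV, Matrix.add_mulVec, Pi.add_apply, Matrix.mulVec_diagonal]
  simp only [Matrix.mulVec, dotProduct, Matrix.of_apply, Finset.sum_mul, ← Finset.sum_add_distrib]
  refine Finset.sum_congr rfl fun j _ => ?_
  ring

/-- Rotational symmetry of `P`: the rows of `Pθ` sum to zero (`Pθ 1 = 0`). [folklore] -/
theorem Pθ_mulVec_one (θ V : Fin n → ℝ) : mg.Pθ θ V *ᵥ (fun _ => (1 : ℝ)) = 0 := by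
  funext i
  rw [Pθ_mulVec]
  simp

/-- Rotational symmetry of `Q`: `Qθ 1 = 0`. [folklore] -/
theorem Qθ_mulVec_one (θ V : Fin n → ℝ) : mg.Qθ θ V *ᵥ (fun _ => (1 : ℝ)) = 0 := by
  funext i
  rw [Qθ_mulVec]
  simp

/-! ## §2 The Jacobian of the full field and the linearisation -/

/-- Frequency-row gain `k_Pi/τ_Pi`. [folklore] -/
def ΛP (i : Fin n) : ℝ := mg.kP i / mg.τP i

/-- Voltage-row gain `k_Qi/τ_Qi`. [folklore] -/
def ΛQ (i : Fin n) : ℝ := mg.kQ i / mg.τQ i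

/-- **The Jacobian matrix of the droop microgrid field (4a)–(4c) at a state with angles `θ` and voltages
`V`** (it does not depend on `ω`), on `Fin n ⊕ (Fin n ⊕ Fin n)` (angles, frequencies, voltages):
`[[0, 1, 0], [−diag(k_P/τ_P)·Pθ, −diag(1/τ_P), −diag(k_P/τ_P)·PV], [−diag(k_Q/τ_Q)·Qθ, 0, −diag(1/τ_Q)·(1 + diag(k_Q)·QV)]]`.
[folklore] -/
def jacMatrix (θ V : Fin n → ℝ) : Matrix (Fin n ⊕ (Fin n ⊕ Fin n)) (Fin n ⊕ (Fin n ⊕ Fin n)) ℝ :=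
  Matrix.fromBlocks 0 (Matrix.fromCols 1 0)
    (Matrix.fromRows (-(Matrix.diagonal mg.ΛP * mg.Pθ θ V)) (-(Matrix.diagonal mg.ΛQ * mg.Qθ θ V)))
    (Matrix.fromBlocks (-Matrix.diagonal fun i => 1 / mg.τP i) (-(Matrix.diagonal mg.ΛP * mg.PV θ V))
      0 (-(Matrix.diagonal (fun i => 1 / mg.τQ i) * (1 + Matrix.diagonal mg.kQ * mg.QV θ V))))

/-- `jacMatrix` acting on `[u; w; e]` (angles, frequencies, voltages), row by row. [folklore] -/
theorem jacMatrix_mulVec (θ V u w e : Fin n → ℝ) :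
    mg.jacMatrix θ V *ᵥ Sum.elim u (Sum.elim w e) =
      Sum.elim w (Sum.elim
        (fun i => -(mg.ΛP i * (mg.Pθ θ V *ᵥ u) i) - w i / mg.τP i - mg.ΛP i * (mg.PV θ V *ᵥ e) i)
        (fun i => -(mg.ΛQ i * (mg.Qθ θ V *ᵥ u) i) - (e i + mg.kQ i * (mg.QV θ V *ᵥ e) i) / mg.τQ i)) := by
  rw [jacMatrix, Matrix.fromBlocks_mulVec, Matrix.fromBlocks_mulVec, Matrix.fromRows_mulVec,
    Matrix.fromCols_mulVec]
  simp only [Sum.elim_comp_inl, Sum.elim_comp_inr, Matrix.zero_mulVec, zero_add, add_zero, Matrix.one_mulVec,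
    Matrix.neg_mulVec, ← Matrix.mulVec_mulVec, Matrix.add_mulVec]
  funext k
  rcases k with i | i | i
  · simp
  · simp only [Sum.elim_inr, Sum.elim_inl, Pi.add_apply, Pi.neg_apply, Matrix.mulVec_diagonal, div_eq_mul_inv]
    ring
  · simp only [Sum.elim_inr, Pi.add_apply, Pi.neg_apply, Matrix.mulVec_diagonal, div_eq_mul_inv]
    ring

/-- The state space `(θ, ω, V)` with its three coordinate projections as continuous linear maps:
`θ_i`. [folklore] -/
def thetaCLM (i : Fin n) : State n →L[ℝ] ℝ :=
  (ContinuousLinearMap.proj (R := ℝ) (φ := fun _ : Fin n => ℝ) i).comp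
    (ContinuousLinearMap.fst ℝ (Fin n → ℝ) ((Fin n → ℝ) × (Fin n → ℝ)))

/-- `ω_i` as a continuous linear functional on the state space. [folklore] -/
def omegaCLM (i : Fin n) : State n →L[ℝ] ℝ :=
  (ContinuousLinearMap.proj (R := ℝ) (φ := fun _ : Fin n => ℝ) i).comp
    ((ContinuousLinearMap.fst ℝ (Fin n → ℝ) (Fin n → ℝ)).comp
      (ContinuousLinearMap.snd ℝ (Fin n → ℝ) ((Fin n → ℝ) × (Fin n → ℝ))))

/-- `V_i` as a continuous linear functional on the state space. [folklore] -/
def voltCLM (i : Fin n) : State n →L[ℝ] ℝ :=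
  (ContinuousLinearMap.proj (R := ℝ) (φ := fun _ : Fin n => ℝ) i).comp
    ((ContinuousLinearMap.snd ℝ (Fin n → ℝ) (Fin n → ℝ)).comp
      (ContinuousLinearMap.snd ℝ (Fin n → ℝ) ((Fin n → ℝ) × (Fin n → ℝ))))

/-- `thetaCLM i (u, w, e) = u_i`. [folklore] -/
@[simp] theorem thetaCLM_apply (i : Fin n) (v : State n) : thetaCLM i v = v.1 i := by
  simp [thetaCLM]

/-- `omegaCLM i (u, w, e) = w_i`. [folklore] -/
@[simp] theorem omegaCLM_apply (i : Fin n) (v : State n) : omegaCLM i v = v.2.1 i := by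
  simp [omegaCLM]

/-- `voltCLM i (u, w, e) = e_i`. [folklore] -/
@[simp] theorem voltCLM_apply (i : Fin n) (v : State n) : voltCLM i v = v.2.2 i := by
  simp [voltCLM]

/-- Derivative of the flow kernel `g_ij(θ)` as a functional: `(−G_ij sin θ_ij + B_ij cos θ_ij)·(u_i − u_j)`,
in the shape the chain rule produces. [folklore] -/
def gPFDeriv (x : State n) (i j : Fin n) : State n →L[ℝ] ℝ :=
  mg.G i j • ((-sin (x.1 i - x.1 j)) • (thetaCLM i - thetaCLM j))
    + mg.B i j • (cos (x.1 i - x.1 j) • (thetaCLM i - thetaCLM j))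

/-- Derivative of `h_ij(θ)`: `(G_ij cos θ_ij + B_ij sin θ_ij)·(u_i − u_j)`, chain-rule shape. [folklore] -/
def gQFDeriv (x : State n) (i j : Fin n) : State n →L[ℝ] ℝ :=
  mg.G i j • (cos (x.1 i - x.1 j) • (thetaCLM i - thetaCLM j))
    - mg.B i j • ((-sin (x.1 i - x.1 j)) • (thetaCLM i - thetaCLM j))

/-- Derivative of the `(i, j)` term `V_iV_j g_ij(θ)` of `P_i`, product-rule shape. [folklore] -/
def PtermFDeriv (x : State n) (i j : Fin n) : State n →L[ℝ] ℝ :=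
  (x.2.2 i * x.2.2 j) • mg.gPFDeriv x i j + mg.gP x.1 i j • (x.2.2 i • voltCLM j + x.2.2 j • voltCLM i)

/-- Derivative of the `(i, j)` term `V_iV_j h_ij(θ)` of `Q_i`, product-rule shape. [folklore] -/
def QtermFDeriv (x : State n) (i j : Fin n) : State n →L[ℝ] ℝ :=
  (x.2.2 i * x.2.2 j) • mg.gQFDeriv x i j + mg.gQ x.1 i j • (x.2.2 i • voltCLM j + x.2.2 j • voltCLM i)

/-- Derivative of `P_i` at `x` as a functional (sum of the term derivatives). [folklore] -/
def PFDeriv (x : State n) (i : Fin n) : State n →L[ℝ] ℝ := ∑ j, mg.PtermFDeriv x i j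

/-- Derivative of `Q_i` at `x` as a functional. [folklore] -/
def QFDeriv (x : State n) (i : Fin n) : State n →L[ℝ] ℝ := ∑ j, mg.QtermFDeriv x i j

/-- `PFDeriv x i v = (Pθ u)_i + (PV e)_i` for `v = (u, w, e)`. [folklore] -/
theorem PFDeriv_apply (x : State n) (i : Fin n) (v : State n) :
    mg.PFDeriv x i v = (mg.Pθ x.1 x.2.2 *ᵥ v.1) i + (mg.PV x.1 x.2.2 *ᵥ v.2.2) i := by
  rw [Pθ_mulVec, PV_mulVec, ← Finset.sum_add_distrib]
  simp only [PFDeriv, FunLike.coe_sum, Finset.sum_apply]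
  refine Finset.sum_congr rfl fun j _ => ?_
  simp only [PtermFDeriv, gPFDeriv, aP, dgP, gP, _root_.add_apply, _root_.smul_apply, _root_.sub_apply,
    thetaCLM_apply, voltCLM_apply, smul_eq_mul]
  ring

/-- `QFDeriv x i v = (Qθ u)_i + (QV e)_i`. [folklore] -/
theorem QFDeriv_apply (x : State n) (i : Fin n) (v : State n) :
    mg.QFDeriv x i v = (mg.Qθ x.1 x.2.2 *ᵥ v.1) i + (mg.QV x.1 x.2.2 *ᵥ v.2.2) i := by
  rw [Qθ_mulVec, QV_mulVec, ← Finset.sum_add_distrib]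
  simp only [QFDeriv, FunLike.coe_sum, Finset.sum_apply]
  refine Finset.sum_congr rfl fun j _ => ?_
  simp only [QtermFDeriv, gQFDeriv, aQ, gP, gQ, _root_.add_apply, _root_.smul_apply, _root_.sub_apply,
    thetaCLM_apply, voltCLM_apply, smul_eq_mul]
  ring

/-- **`P_i` is Fréchet differentiable at every state, with derivative `PFDeriv x i`.** [folklore] -/
theorem hasFDerivAt_P (x : State n) (i : Fin n) :
    HasFDerivAt (fun y : State n => mg.P y.1 y.2.2 i) (mg.PFDeriv x i) x := by
  have hfst : HasFDerivAt (fun y : State n => y.1) (ContinuousLinearMap.fst ℝ _ _) x := hasFDerivAt_fst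
  have hsnd : HasFDerivAt (fun y : State n => y.2) (ContinuousLinearMap.snd ℝ _ _) x := hasFDerivAt_snd
  have hθ : ∀ k : Fin n, HasFDerivAt (fun y : State n => y.1 k) (thetaCLM k) x := by
    intro k
    refine ((hasFDerivAt_apply (𝕜 := ℝ) k x.1).comp x hfst).congr_fderiv ?_
    ext v <;> simp [thetaCLM]
  have hV : ∀ k : Fin n, HasFDerivAt (fun y : State n => y.2.2 k) (voltCLM k) x := by
    intro k
    have h22 : HasFDerivAt (fun y : State n => y.2.2)
        ((ContinuousLinearMap.snd ℝ _ _).comp (ContinuousLinearMap.snd ℝ _ _)) x :=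
      hasFDerivAt_snd.comp x hsnd
    refine ((hasFDerivAt_apply (𝕜 := ℝ) k x.2.2).comp x h22).congr_fderiv ?_
    ext v <;> simp [voltCLM]
  have hθd : ∀ a b : Fin n, HasFDerivAt (fun y : State n => y.1 a - y.1 b) (thetaCLM a - thetaCLM b) x :=
    fun a b => (hθ a).sub (hθ b)
  have hg : ∀ j : Fin n, HasFDerivAt (fun y : State n => mg.gP y.1 i j) (mg.gPFDeriv x i j) x := by
    intro j
    unfold gP gPFDeriv
    exact (((Real.hasDerivAt_cos _).comp_hasFDerivAt x (hθd i j)).const_mul (mg.G i j)).add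
      (((Real.hasDerivAt_sin _).comp_hasFDerivAt x (hθd i j)).const_mul (mg.B i j))
  unfold DroopMicrogrid.P PFDeriv
  exact HasFDerivAt.fun_sum fun j _ => ((hV i).mul (hV j)).mul (hg j)

/-- **`Q_i` is Fréchet differentiable at every state, with derivative `QFDeriv x i`.** [folklore] -/
theorem hasFDerivAt_Q (x : State n) (i : Fin n) :
    HasFDerivAt (fun y : State n => mg.Q y.1 y.2.2 i) (mg.QFDeriv x i) x := by
  have hfst : HasFDerivAt (fun y : State n => y.1) (ContinuousLinearMap.fst ℝ _ _) x := hasFDerivAt_fst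
  have hsnd : HasFDerivAt (fun y : State n => y.2) (ContinuousLinearMap.snd ℝ _ _) x := hasFDerivAt_snd
  have hθ : ∀ k : Fin n, HasFDerivAt (fun y : State n => y.1 k) (thetaCLM k) x := by
    intro k
    refine ((hasFDerivAt_apply (𝕜 := ℝ) k x.1).comp x hfst).congr_fderiv ?_
    ext v <;> simp [thetaCLM]
  have hV : ∀ k : Fin n, HasFDerivAt (fun y : State n => y.2.2 k) (voltCLM k) x := by
    intro k
    have h22 : HasFDerivAt (fun y : State n => y.2.2)
        ((ContinuousLinearMap.snd ℝ _ _).comp (ContinuousLinearMap.snd ℝ _ _)) x :=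
      hasFDerivAt_snd.comp x hsnd
    refine ((hasFDerivAt_apply (𝕜 := ℝ) k x.2.2).comp x h22).congr_fderiv ?_
    ext v <;> simp [voltCLM]
  have hθd : ∀ a b : Fin n, HasFDerivAt (fun y : State n => y.1 a - y.1 b) (thetaCLM a - thetaCLM b) x :=
    fun a b => (hθ a).sub (hθ b)
  have hg : ∀ j : Fin n, HasFDerivAt (fun y : State n => mg.gQ y.1 i j) (mg.gQFDeriv x i j) x := by
    intro j
    unfold gQ gQFDeriv
    exact (((Real.hasDerivAt_sin _).comp_hasFDerivAt x (hθd i j)).const_mul (mg.G i j)).sub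
      (((Real.hasDerivAt_cos _).comp_hasFDerivAt x (hθd i j)).const_mul (mg.B i j))
  unfold DroopMicrogrid.Q QFDeriv
  exact HasFDerivAt.fun_sum fun j _ => ((hV i).mul (hV j)).mul (hg j)

/-- **The Jacobian as a continuous linear map on the state space** `(θ, ω, V)`:
`(u, w, e) ↦ (w, (−k_P((Pθ u) + (PV e)) − w)/τ_P, (−e − k_Q((Qθ u) + (QV e)))/τ_Q)`. [folklore] -/
def jacCLM (x : State n) : State n →L[ℝ] State n :=
  ((ContinuousLinearMap.fst ℝ (Fin n → ℝ) (Fin n → ℝ)).comp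
      (ContinuousLinearMap.snd ℝ (Fin n → ℝ) ((Fin n → ℝ) × (Fin n → ℝ)))).prod
    ((ContinuousLinearMap.pi fun i => (mg.τP i)⁻¹ • (-(omegaCLM i) - mg.kP i • mg.PFDeriv x i)).prod
      (ContinuousLinearMap.pi fun i => (mg.τQ i)⁻¹ • (-(voltCLM i) - mg.kQ i • mg.QFDeriv x i)))

/-- `jacCLM x (u, w, e)` componentwise. [folklore] -/
theorem jacCLM_apply (x v : State n) :
    mg.jacCLM x v = (v.2.1,
      fun i => (-v.2.1 i - mg.kP i * ((mg.Pθ x.1 x.2.2 *ᵥ v.1) i + (mg.PV x.1 x.2.2 *ᵥ v.2.2) i)) / mg.τP i,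
      fun i => (-v.2.2 i - mg.kQ i * ((mg.Qθ x.1 x.2.2 *ᵥ v.1) i + (mg.QV x.1 x.2.2 *ᵥ v.2.2) i)) / mg.τQ i) := by
  refine Prod.ext ?_ (Prod.ext ?_ ?_)
  · simp [jacCLM]
  · funext i
    simp only [jacCLM, ContinuousLinearMap.prod_apply, ContinuousLinearMap.pi_apply, _root_.smul_apply,
      _root_.sub_apply, _root_.neg_apply, PFDeriv_apply, omegaCLM_apply, smul_eq_mul]
    ring
  · funext i
    simp only [jacCLM, ContinuousLinearMap.prod_apply, ContinuousLinearMap.pi_apply, _root_.smul_apply,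
      _root_.sub_apply, _root_.neg_apply, QFDeriv_apply, voltCLM_apply, smul_eq_mul]
    ring

/-- **`jacCLM` IS the block matrix `jacMatrix`** acting on `[u; w; e]`. [folklore] -/
theorem jacCLM_eq_mulVec (x v : State n) :
    mg.jacCLM x v =
      (fun i => (mg.jacMatrix x.1 x.2.2 *ᵥ Sum.elim v.1 (Sum.elim v.2.1 v.2.2)) (Sum.inl i),
       fun i => (mg.jacMatrix x.1 x.2.2 *ᵥ Sum.elim v.1 (Sum.elim v.2.1 v.2.2)) (Sum.inr (Sum.inl i)),
       fun i => (mg.jacMatrix x.1 x.2.2 *ᵥ Sum.elim v.1 (Sum.elim v.2.1 v.2.2)) (Sum.inr (Sum.inr i))) := by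
  rw [jacCLM_apply, jacMatrix_mulVec]
  refine Prod.ext ?_ (Prod.ext ?_ ?_)
  · funext i; simp
  · funext i
    simp only [Sum.elim_inr, Sum.elim_inl, ΛP]
    field_simp
    ring
  · funext i
    simp only [Sum.elim_inr, ΛQ]
    ring

/-- **Linearisation (kernel fact): the droop-microgrid field (4a)–(4c) WITH voltage dynamics is Fréchet
differentiable at EVERY state `(θ, ω, V)`, with derivative `jacCLM x`** (= the block matrix
`jacMatrix (θ, V)`, `jacCLM_eq_mulVec`); no hypothesis on gains, time constants or the network.
MODELLED: MV-6N + MV-6D. [folklore] -/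
theorem hasFDerivAt_field (x : State n) : HasFDerivAt mg.field (mg.jacCLM x) x := by
  have hsnd : HasFDerivAt (fun y : State n => y.2) (ContinuousLinearMap.snd ℝ _ _) x := hasFDerivAt_snd
  have h21 : HasFDerivAt (fun y : State n => y.2.1)
      ((ContinuousLinearMap.fst ℝ _ _).comp (ContinuousLinearMap.snd ℝ _ _)) x :=
    hasFDerivAt_fst.comp x hsnd
  have h22 : HasFDerivAt (fun y : State n => y.2.2)
      ((ContinuousLinearMap.snd ℝ _ _).comp (ContinuousLinearMap.snd ℝ _ _)) x :=
    hasFDerivAt_snd.comp x hsnd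
  have hω : ∀ k : Fin n, HasFDerivAt (fun y : State n => y.2.1 k) (omegaCLM k) x := by
    intro k
    refine ((hasFDerivAt_apply (𝕜 := ℝ) k x.2.1).comp x h21).congr_fderiv ?_
    ext v <;> simp [omegaCLM]
  have hV : ∀ k : Fin n, HasFDerivAt (fun y : State n => y.2.2 k) (voltCLM k) x := by
    intro k
    refine ((hasFDerivAt_apply (𝕜 := ℝ) k x.2.2).comp x h22).congr_fderiv ?_
    ext v <;> simp [voltCLM]
  have hfield : mg.field = fun y : State n =>
      (y.2.1, fun i => (-y.2.1 i + mg.kP i * (mg.Pset i - mg.P y.1 y.2.2 i)) * (mg.τP i)⁻¹,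
        fun i => (mg.Vset i - y.2.2 i + mg.kQ i * (mg.Qset i - mg.Q y.1 y.2.2 i)) * (mg.τQ i)⁻¹) := by
    funext y
    refine Prod.ext rfl (Prod.ext ?_ ?_) <;> funext i <;> simp [field, dω, dV, div_eq_mul_inv]
  rw [hfield]
  refine h21.prodMk ((hasFDerivAt_pi.2 fun i => ?_).prodMk (hasFDerivAt_pi.2 fun i => ?_))
  · have h := (((hω i).neg).add (((mg.hasFDerivAt_P x i).const_sub (mg.Pset i)).const_mul (mg.kP i))).mul_const
      (mg.τP i)⁻¹
    refine h.congr_fderiv ?_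
    ext v <;> simp [sub_eq_add_neg, PFDeriv_apply]
  · have h := ((((hV i).const_sub (mg.Vset i))).add
      (((mg.hasFDerivAt_Q x i).const_sub (mg.Qset i)).const_mul (mg.kQ i))).mul_const (mg.τQ i)⁻¹
    refine h.congr_fderiv ?_
    ext v <;> simp [sub_eq_add_neg, QFDeriv_apply]

/-! ## §3 The rotation mode -/

/-- **The rotation mode.** For every parameter set and every state, the uniform angle shift `[1; 0; 0]` is
in the kernel of the Jacobian (`P`, `Q` see only angle differences): no Lyapunov matrix exists for
`jacMatrix` itself; point certificates live on the quotient. [folklore] -/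
theorem jacMatrix_mulVec_rotation (θ V : Fin n → ℝ) :
    mg.jacMatrix θ V *ᵥ Sum.elim (fun _ => (1 : ℝ)) (Sum.elim 0 0) = 0 := by
  rw [jacMatrix_mulVec, Pθ_mulVec_one, Qθ_mulVec_one]
  funext k
  rcases k with i | i | i <;> simp [Matrix.mulVec_zero]

end DroopMicrogrid

end Summit.Ventures.GridStability.Models

end
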